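import Mathlib
import HarnessLib
import Summits.HubbardSuperconductivity.HubbardSuperconductivity.Theorems.KLProgrammeKLRegimeWickAbsChannelsSum

/-!
# Route `KLProgramme` — ENGINE child (gen-6 `KLRegimeEngineV16`, stmt-HubbardSuperconductivity-20236), stub `stub_engine_step_values`, (E2): the three-channel
# reading at GENERAL EXTERNAL FREQUENCIES `x = (k, ω)`, `y = (k′, ω′)` for an arbitrary scaling-invariant even vertex `W` — part 1: selection rules, pp, ph-direct
# (E2-WICK-ROADMAP §5 (iii-g); cell gate-hubbard-kl, seat p1 g9; for the continuous route's full source matrix on `S × F`)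

The identities of `…WickAbsChannels` / `…WickAbsChannelsSum` (abstract `W`, external frequencies `ω₀`) re-derived with the two external pair
frequencies free: the incoming pair `((ω,k)↑−, (−ω,Q−k)↓−)` and the outgoing pair `((ω′,k′)↑+, (−ω′,Q−k′)↓+)`.  What changes: the direct
particle–hole transfer now carries the frequency `ω − ω′` (`n(p′) + n(ω′) = n(p) + n(ω)`), the crossed one `ω + ω′` (`n(p′) + n(ω) + n(ω′) + 1 = n(p)`);
both are written as CONDITIONAL loop sums; the particle–particle channel is unchanged in form.  §1 selection rules `kernel_phd_eq_zero_of_not_gen`,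
`kernel_phx_eq_zero_of_not_gen`; §2 `bubbleSumW_pp_general`, `bubbleSumW_phDirect_general`.  The crossed channel and the assembled identity
`vertexFnW_dblFold_bubble_general` are in `…WickAbsChannelsGeneralSum`.  Proved; no definitions.
-/

noncomputable section

namespace Summit.HubbardSuperconductivity.HubbardSuperconductivity.Theorems.KLRegimeWickAbs

set_option linter.dupNamespace false -- summit = problem name (single-conjunct summit), D-0017

open Literature.MathematicalPhysics.QuantumLattice GrassmannAlgebra Finset Matrix
open Literature.Probability.LatticeModels
open Summit.HubbardSuperconductivity.HubbardSuperconductivity.Theorems.TwoPointAssembly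
open Summit.HubbardSuperconductivity.HubbardSuperconductivity.Theorems.KLProgrammeLegKernels
open Summit.HubbardSuperconductivity.HubbardSuperconductivity.Theorems.KLRegimeSplit
open Summit.HubbardSuperconductivity.HubbardSuperconductivity.Theorems.KLRegimeWick

section Model

variable {L M : ℕ} [NeZero L] [NeZero M] (β : ℝ) {W : HubbardGrassmann L M}
  (hWinv : ∀ φ : FreqMomentum L M × Fin 2 → ℂ, (∀ p, φ p ≠ 0) →
    (∀ k₁ k₂ k₃ k₄ : FreqMomentum L M,
      matsubaraInt M k₁.1 + matsubaraInt M k₃.1 = matsubaraInt M k₂.1 + matsubaraInt M k₄.1 ∧ k₁.2 + k₃.2 = k₂.2 + k₄.2 →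
        φ (k₁, 0) * φ (k₃, 1) = φ (k₂, 0) * φ (k₄, 1)) →
    ExteriorAlgebra.map (LinearMap.mulLeft ℂ (scalingWeight φ)) W = W)
include hWinv

/-! ## §1 Selection rules at the particle–hole vertices with general external frequencies -/

omit [NeZero M] in
/-- At the DIRECT particle–hole vertex `((ω′,k′)↑+, (ω,k)↑−)`: the line ends `ψ̂⁻_{pσ}, ψ̂⁺_{p′σ′}` carry the kernel only if
`n(p′) + n(ω′) = n(p) + n(ω)`, `p⃗′ = p⃗ + k − k′`, `σ′ = σ`. -/
theorem kernel_phd_eq_zero_of_not_gen (k k' : TorusSite 2 L) (ω ω' : MatsubaraIdx M) (p p' : FreqMomentum L M) (σ σ' : Fin 2)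
    (h : ¬(matsubaraInt M p'.1 + matsubaraInt M ω' = matsubaraInt M p.1 + matsubaraInt M ω ∧ p'.2 = p.2 + k - k' ∧ σ' = σ)) :
    kernel ℂ W 4 ![((p, σ), 1), ((p', σ'), 0), (((ω', k'), 0), 0), (((ω, k), 0), 1)] = 0 := by
  by_cases hσ : σ' = σ
  · subst hσ
    by_cases hf : matsubaraInt M p'.1 + matsubaraInt M ω' = matsubaraInt M p.1 + matsubaraInt M ω
    · have hm : p'.2 ≠ p.2 + k - k' := fun h2 => h ⟨hf, h2, rfl⟩
      have : ∃ j : Fin 2, p'.2 j ≠ (p.2 + k - k') j := by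
        by_contra hall
        push Not at hall
        exact hm (funext hall)
      obtain ⟨j, hj⟩ := this
      refine kernel_eq_zero_of_momentum hWinv j ?_
      simp only [Fin.sum_univ_four, Matrix.cons_val_zero, Matrix.cons_val_one, Matrix.head_cons, Matrix.cons_val_two, Matrix.tail_cons,
        Matrix.cons_val_three, Fin.isValue, if_true, one_ne_zero, if_false, one_smul, neg_smul]
      intro h0
      apply hj
      rw [Pi.sub_apply, Pi.add_apply]
      linear_combination h0
    · refine kernel_eq_zero_of_freq hWinv ?_
      simp only [Fin.sum_univ_four, Matrix.cons_val_zero, Matrix.cons_val_one, Matrix.head_cons, Matrix.cons_val_two, Matrix.tail_cons,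
        Matrix.cons_val_three, Fin.isValue, if_true, one_ne_zero, if_false, one_mul, neg_mul]
      intro h0
      apply hf
      linarith
  · refine kernel_eq_zero_of_spin hWinv ?_
    fin_cases σ <;> fin_cases σ' <;> first | exact absurd rfl hσ | simp [Fin.sum_univ_four]

omit [NeZero M] in
/-- At the CROSSED particle–hole vertex `((ω′,k′)↑+, (−ω,Q−k)↓−)`: the line ends `ψ̂⁻_{pσ}, ψ̂⁺_{p′σ′}` carry the kernel only if
`n(p′) + n(ω) + n(ω′) + 1 = n(p)`, `p⃗′ = p⃗ + Q − k − k′`, `(σ,σ′) = (↑,↓)`. -/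
theorem kernel_phx_eq_zero_of_not_gen (Q k k' : TorusSite 2 L) (ω ω' : MatsubaraIdx M) (p p' : FreqMomentum L M) (σ σ' : Fin 2)
    (h : ¬(matsubaraInt M p'.1 + matsubaraInt M ω + matsubaraInt M ω' + 1 = matsubaraInt M p.1 ∧ p'.2 = p.2 + Q - k - k' ∧ σ = 0 ∧ σ' = 1)) :
    kernel ℂ W 4 ![((p, σ), 1), ((p', σ'), 0), (((ω', k'), 0), 0), (((ω.rev, Q - k), 1), 1)] = 0 := by
  by_cases hs : σ = 0 ∧ σ' = 1
  · obtain ⟨rfl, rfl⟩ := hs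
    by_cases hf : matsubaraInt M p'.1 + matsubaraInt M ω + matsubaraInt M ω' + 1 = matsubaraInt M p.1
    · have hm : p'.2 ≠ p.2 + Q - k - k' := fun h2 => h ⟨hf, h2, rfl, rfl⟩
      have : ∃ j : Fin 2, p'.2 j ≠ (p.2 + Q - k - k') j := by
        by_contra hall
        push Not at hall
        exact hm (funext hall)
      obtain ⟨j, hj⟩ := this
      refine kernel_eq_zero_of_momentum hWinv j ?_
      simp only [Fin.sum_univ_four, Matrix.cons_val_zero, Matrix.cons_val_one, Matrix.head_cons, Matrix.cons_val_two, Matrix.tail_cons,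
        Matrix.cons_val_three, Fin.isValue, if_true, one_ne_zero, if_false, one_smul, neg_smul, Pi.sub_apply]
      intro h0
      apply hj
      rw [Pi.sub_apply, Pi.sub_apply, Pi.add_apply]
      linear_combination h0
    · refine kernel_eq_zero_of_freq hWinv ?_
      simp only [Fin.sum_univ_four, Matrix.cons_val_zero, Matrix.cons_val_one, Matrix.head_cons, Matrix.cons_val_two, Matrix.tail_cons,
        Matrix.cons_val_three, Fin.isValue, if_true, one_ne_zero, if_false, one_mul, neg_mul, matsubaraInt_rev]
      intro h0
      apply hf
      linarith
  · refine kernel_eq_zero_of_spin hWinv ?_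
    fin_cases σ <;> fin_cases σ' <;> first | exact absurd ⟨rfl, rfl⟩ hs | simp [Fin.sum_univ_four]

/-! ## §2 The three channels at general external frequencies -/

omit [NeZero M] in
/-- **`bubbleSumW_pp_general`** — the particle–particle channel of `kernel_dblFold_bubble_self` at the pair labels with GENERAL external
frequencies (`(k, ω)` incoming, `(k′, ω′)` outgoing; cf. `bubbleSumW_pp_pairLabels` at `ω = ω′ = ω₀`), for a scaling-invariant `W` and diagonal
lines `C₁, C₂` with values `ℓ₁, ℓ₂`:
`Σ_{X,Y,X',Y'} contr C₂ X Y · contr C₁ X' Y' · kernel W 4 (X, X', (−ω,Q−k)↓−, (ω,k)↑−) · kernel W 4 (Y, Y', (ω′,k′)↑+, (−ω′,Q−k′)↓+)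
   = −c₄⁻²·Σ_{x=(p⃗,ν)} λ(x)·𝒱₄(W)(x↑+, x̄↓+, (−ω,Q−k)↓−, (ω,k)↑−)·𝒱₄(W)((ω′,k′)↑+, (−ω′,Q−k′)↓+, x̄↓−, x↑−)`,
`λ(x) = ℓ₂(x)ℓ₁(x̄) + ℓ₁(x)ℓ₂(x̄)`, `x̄ = (−ν, Q−p⃗)`, `c₄ = 4!(βL²)³` — the loop label runs over the whole carrier; no frequency constraint couples
it to `ω, ω′` (total pair frequency is zero on both sides).  Lines: `contr ℂ Cᵢ = diagContr ℓᵢ`. -/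
theorem bubbleSumW_pp_general (hβ : β ≠ 0) (ω ω' : MatsubaraIdx M) {C₁ C₂ : Matrix (HubbardFieldIdx L M) (HubbardFieldIdx L M) ℂ} {ℓ₁ ℓ₂ : FreqMomentum L M → ℂ}
    (h₁ : contr ℂ C₁ = diagContr L M ℓ₁) (h₂ : contr ℂ C₂ = diagContr L M ℓ₂) (Q k k' : TorusSite 2 L) :
    ∑ X, ∑ Y, ∑ X', ∑ Y', contr ℂ C₂ X Y * contr ℂ C₁ X' Y' *
        (kernel ℂ W 4 ![X, X', (((ω.rev, Q - k), 1), 1), (((ω, k), 0), 1)] *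
          kernel ℂ W 4 ![Y, Y', (((ω', k'), 0), 0), (((ω'.rev, Q - k'), 1), 0)]) =
      -((((Nat.factorial 4 : ℝ) * (β * (L : ℝ) ^ 2) ^ 3 : ℝ) : ℂ)⁻¹ ^ 2 *
        ∑ x : TorusSite 2 L × MatsubaraIdx M,
          (ℓ₂ (x.2, x.1) * ℓ₁ (x.2.rev, Q - x.1) + ℓ₁ (x.2, x.1) * ℓ₂ (x.2.rev, Q - x.1)) *
            (vertexFn L M β W 4 ![(((x.2, x.1), 0), 0), (((x.2.rev, Q - x.1), 1), 0), (((ω.rev, Q - k), 1), 1), (((ω, k), 0), 1)] *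
              vertexFn L M β W 4 ![(((ω', k'), 0), 0), (((ω'.rev, Q - k'), 1), 0), (((x.2.rev, Q - x.1), 1), 1), (((x.2, x.1), 0), 1)])) := by
  set c : ℂ := (((Nat.factorial 4 : ℝ) * (β * (L : ℝ) ^ 2) ^ 3 : ℝ) : ℂ) with hc
  set Z₂ : HubbardFieldIdx L M := (((ω.rev, Q - k), 1), 1) with hZ₂
  set Z₃ : HubbardFieldIdx L M := (((ω, k), 0), 1) with hZ₃
  set Z₀ : HubbardFieldIdx L M := (((ω', k'), 0), 0) with hZ₀
  set Z₁ : HubbardFieldIdx L M := (((ω'.rev, Q - k'), 1), 0) with hZ₁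
  -- Step 1: both lines are reciprocal pairs read in both orientations
  rw [h₁, h₂]
  simp_rw [mul_assoc, ← Finset.mul_sum]
  rw [sum_diagContr_mul]
  simp_rw [sum_diagContr_mul]
  -- Step 2: charge conservation at the `a`-vertex (incoming legs `ψ̂⁻ψ̂⁻`): only `ψ̂⁺ψ̂⁺` line ends survive
  have hv1 : ∀ (p : FreqMomentum L M) (σ : Fin 2) (X' : HubbardFieldIdx L M), kernel ℂ W 4 ![((p, σ), 1), X', Z₂, Z₃] = 0 :=
    fun p σ X' => kernel_pp_minus_left hWinv p σ X' _ _
  have hv2 : ∀ (X : HubbardFieldIdx L M) (p' : FreqMomentum L M) (σ' : Fin 2), kernel ℂ W 4 ![X, ((p', σ'), 1), Z₂, Z₃] = 0 :=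
    fun X p' σ' => kernel_pp_minus_right hWinv X p' σ' _ _
  simp only [hv1, hv2, zero_mul, mul_zero, sub_zero, zero_sub, Finset.sum_neg_distrib, mul_neg]
  -- Step 3: momentum + frequency conservation: the second line sits at the pair partner `p̄`
  have hstep3 : ∀ (p : FreqMomentum L M) (σ : Fin 2),
      ∑ p' : FreqMomentum L M, ∑ σ' : Fin 2, ℓ₁ p' * (kernel ℂ W 4 ![((p, σ), 0), ((p', σ'), 0), Z₂, Z₃] *
          kernel ℂ W 4 ![((p, σ), 1), ((p', σ'), 1), Z₀, Z₁]) =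
        ∑ σ' : Fin 2, ℓ₁ (p.1.rev, Q - p.2) * (kernel ℂ W 4 ![((p, σ), 0), (((p.1.rev, Q - p.2), σ'), 0), Z₂, Z₃] *
          kernel ℂ W 4 ![((p, σ), 1), (((p.1.rev, Q - p.2), σ'), 1), Z₀, Z₁]) := by
    intro p σ
    refine Finset.sum_eq_single (p.1.rev, Q - p.2) (fun p' _ hp' => ?_) (fun h => absurd (Finset.mem_univ _) h)
    refine Finset.sum_eq_zero fun σ' _ => ?_
    rw [kernel_pp_eq_zero_of_ne_partner hWinv Q k ω p p' σ σ' hp', zero_mul, mul_zero]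
  simp only [hstep3]
  -- Step 4: spin conservation: the internal pair carries opposite spins
  have hspin : ∀ (p : FreqMomentum L M) (σ : Fin 2),
      kernel ℂ W 4 ![((p, σ), 0), (((p.1.rev, Q - p.2), σ), 0), Z₂, Z₃] = 0 :=
    fun p σ => kernel_pp_eq_zero_of_spin_eq hWinv Q k ω p _ σ
  simp only [Fin.sum_univ_two, hspin, zero_mul, mul_zero, zero_add, add_zero, Fin.isValue]
  simp only [Finset.sum_const_zero, zero_sub, neg_neg]
  -- Step 5: the `(↓,↑)` assignment is the `(↑,↓)` one at the partner (involution + antisymmetry)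
  rw [Finset.sum_add_distrib]
  have hre : ∑ p : FreqMomentum L M, ℓ₂ p * (ℓ₁ (p.1.rev, Q - p.2) *
        (kernel ℂ W 4 ![((p, 1), 0), (((p.1.rev, Q - p.2), 0), 0), Z₂, Z₃] * kernel ℂ W 4 ![((p, 1), 1), (((p.1.rev, Q - p.2), 0), 1), Z₀, Z₁])) =
      ∑ p : FreqMomentum L M, ℓ₂ (p.1.rev, Q - p.2) * (ℓ₁ p *
        (kernel ℂ W 4 ![((p, 0), 0), (((p.1.rev, Q - p.2), 1), 0), Z₂, Z₃] * kernel ℂ W 4 ![((p, 0), 1), (((p.1.rev, Q - p.2), 1), 1), Z₀, Z₁])) := by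
    refine Fintype.sum_bijective (fun p : FreqMomentum L M => ((p.1.rev, Q - p.2) : FreqMomentum L M)) (pairPartner_involutive Q).bijective
      _ _ (fun p => ?_)
    simp only [Fin.rev_rev, sub_sub_cancel, Prod.mk.eta]
    rw [kernel_four_swap01 W ((p, 1), 0), kernel_four_swap01 W ((p, 1), 1)]
    ring
  rw [hre, ← Finset.sum_add_distrib]
  -- Step 6: read the two surviving kernels as entries of the frequency-resolved pair kernel
  rw [← Equiv.sum_comp (Equiv.prodComm (MatsubaraIdx M) (TorusSite 2 L)), Finset.mul_sum, ← Finset.sum_neg_distrib]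
  refine Finset.sum_congr rfl fun p _ => ?_
  simp only [Equiv.prodComm_apply, Prod.swap, Prod.mk.eta]
  rw [kernel_four_cycle W Z₀ Z₁ (((p.1.rev, Q - p.2), 1), 1) ((p, 0), 1), kernel_four_eq_inv_mul_vertexFn β hβ W,
    kernel_four_eq_inv_mul_vertexFn β hβ W]
  ring



omit [NeZero M] in
/-- **`bubbleSumW_phDirect_general`** — the direct particle–hole channel of `kernel_dblFold_bubble_self` at the pair labels with GENERAL external
frequencies (`a`-legs `Z₀ = (ω′,k′)↑+`, `Z₃ = (ω,k)↑−`; `b`-legs `Z₁ = (−ω′,Q−k′)↓+`, `Z₂ = (−ω,Q−k)↓−`; cf. `bubbleSumW_phDirect_pairLabels` at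
`ω = ω′ = ω₀`), for diagonal lines: a loop sum over `(p, σ)` with the second line end `p′` restricted by the conservation condition at the
`a`-vertex — frequency transfer `ω − ω′` (`n(p′) + n(ω′) = n(p) + n(ω)`), momentum transfer `k − k′` (`p⃗′ = p⃗ + k − k′`), same spin:
`= −c₄⁻²·Σ_{p,σ} Σ_{p′} [cond]·(ℓ₂(p)ℓ₁(p′) + ℓ₁(p)ℓ₂(p′))·𝒱₄(W)(ψ̂⁻_{pσ}, ψ̂⁺_{p′σ}, Z₀, Z₃)·𝒱₄(W)(ψ̂⁺_{pσ}, ψ̂⁻_{p′σ}, Z₁, Z₂)`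
(at the finite-`M` edge the condition may be empty for some `p`: the conditional form is exact at every `M`). -/
theorem bubbleSumW_phDirect_general (hβ : β ≠ 0) (ω ω' : MatsubaraIdx M) {C₁ C₂ : Matrix (HubbardFieldIdx L M) (HubbardFieldIdx L M) ℂ}
    {ℓ₁ ℓ₂ : FreqMomentum L M → ℂ} (h₁ : contr ℂ C₁ = diagContr L M ℓ₁) (h₂ : contr ℂ C₂ = diagContr L M ℓ₂) (Q k k' : TorusSite 2 L) :
    ∑ X, ∑ Y, ∑ X', ∑ Y', contr ℂ C₂ X Y * contr ℂ C₁ X' Y' *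
        (kernel ℂ W 4 ![X, X', (((ω', k'), 0), 0), (((ω, k), 0), 1)] *
          kernel ℂ W 4 ![Y, Y', (((ω'.rev, Q - k'), 1), 0), (((ω.rev, Q - k), 1), 1)]) =
      -((((Nat.factorial 4 : ℝ) * (β * (L : ℝ) ^ 2) ^ 3 : ℝ) : ℂ)⁻¹ ^ 2 *
        ∑ p : FreqMomentum L M, ∑ σ : Fin 2, ∑ p' : FreqMomentum L M,
          if matsubaraInt M p'.1 + matsubaraInt M ω' = matsubaraInt M p.1 + matsubaraInt M ω ∧ p'.2 = p.2 + k - k' then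
            (ℓ₂ p * ℓ₁ p' + ℓ₁ p * ℓ₂ p') *
              (vertexFn L M β W 4 ![((p, σ), 1), ((p', σ), 0), (((ω', k'), 0), 0), (((ω, k), 0), 1)] *
                vertexFn L M β W 4 ![((p, σ), 0), ((p', σ), 1), (((ω'.rev, Q - k'), 1), 0), (((ω.rev, Q - k), 1), 1)])
          else 0) := by
  set Z₀ : HubbardFieldIdx L M := (((ω', k'), 0), 0) with hZ₀
  set Z₃ : HubbardFieldIdx L M := (((ω, k), 0), 1) with hZ₃
  set Z₁ : HubbardFieldIdx L M := (((ω'.rev, Q - k'), 1), 0) with hZ₁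
  set Z₂ : HubbardFieldIdx L M := (((ω.rev, Q - k), 1), 1) with hZ₂
  -- Step 1: line reductions
  rw [h₁, h₂]
  simp_rw [mul_assoc, ← Finset.mul_sum]
  rw [sum_diagContr_mul]
  simp_rw [sum_diagContr_mul]
  -- Step 2: charge conservation at the `a`-vertex (legs `ψ̂⁺ψ̂⁻`): equal-charge line ends die
  have hv : ∀ (p p' : FreqMomentum L M) (σ σ' c : Fin 2), kernel ℂ W 4 ![((p, σ), c), ((p', σ'), c), Z₀, Z₃] = 0 :=
    fun p p' σ σ' c => kernel_ph_same_charge hWinv p p' σ σ' c _ _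
  simp only [hv, zero_mul, sub_zero, zero_sub, mul_neg, Finset.sum_neg_distrib, Finset.mul_sum]
  -- Step 3: the two orientation terms merge (exchange the summation pairs, antisymmetry twice)
  have hB : ∑ p : FreqMomentum L M, ∑ σ : Fin 2, ∑ p' : FreqMomentum L M, ∑ σ' : Fin 2, ℓ₂ p * (ℓ₁ p' *
        (kernel ℂ W 4 ![((p, σ), 0), ((p', σ'), 1), Z₀, Z₃] * kernel ℂ W 4 ![((p, σ), 1), ((p', σ'), 0), Z₁, Z₂])) =
      ∑ p : FreqMomentum L M, ∑ σ : Fin 2, ∑ p' : FreqMomentum L M, ∑ σ' : Fin 2, ℓ₂ p' * (ℓ₁ p *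
        (kernel ℂ W 4 ![((p, σ), 1), ((p', σ'), 0), Z₀, Z₃] * kernel ℂ W 4 ![((p, σ), 0), ((p', σ'), 1), Z₁, Z₂])) := by
    rw [sum_swap_pairs]
    refine Finset.sum_congr rfl fun p _ => Finset.sum_congr rfl fun σ _ => Finset.sum_congr rfl fun p' _ =>
      Finset.sum_congr rfl fun σ' _ => ?_
    rw [kernel_four_swap01 W ((p, σ), 1) ((p', σ'), 0), kernel_four_swap01 W ((p, σ), 0) ((p', σ'), 1)]
    ring
  -- Step 4: conservation at the `a`-vertex: `σ′ = σ`, frequency `n(p′) + n(ω′) = n(p) + n(ω)`, momentum `p⃗′ = p⃗ + k − k′`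
  have hcons : ∀ (p : FreqMomentum L M) (σ : Fin 2) (g : FreqMomentum L M → FreqMomentum L M → ℂ),
      ∑ p' : FreqMomentum L M, ∑ σ' : Fin 2, g p p' *
        (kernel ℂ W 4 ![((p, σ), 1), ((p', σ'), 0), Z₀, Z₃] * kernel ℂ W 4 ![((p, σ), 0), ((p', σ'), 1), Z₁, Z₂]) =
      ∑ p' : FreqMomentum L M, if matsubaraInt M p'.1 + matsubaraInt M ω' = matsubaraInt M p.1 + matsubaraInt M ω ∧ p'.2 = p.2 + k - k' then
        g p p' * (kernel ℂ W 4 ![((p, σ), 1), ((p', σ), 0), Z₀, Z₃] * kernel ℂ W 4 ![((p, σ), 0), ((p', σ), 1), Z₁, Z₂]) else 0 := by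
    intro p σ g
    have hz : ∀ (τ : Fin 2) (p' : FreqMomentum L M) (σ' : Fin 2),
        ¬(matsubaraInt M p'.1 + matsubaraInt M ω' = matsubaraInt M p.1 + matsubaraInt M ω ∧ p'.2 = p.2 + k - k' ∧ σ' = τ) →
          kernel ℂ W 4 ![((p, τ), 1), ((p', σ'), 0), Z₀, Z₃] = 0 :=
      fun τ p' σ' h => kernel_phd_eq_zero_of_not_gen hWinv k k' ω ω' p p' τ σ' h
    refine Finset.sum_congr rfl fun p' _ => ?_
    fin_cases σ
    · simp only [Fin.sum_univ_two, Fin.zero_eta, Fin.isValue]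
      rw [hz 0 p' 1 (by simp), zero_mul, mul_zero, add_zero]
      by_cases hc : matsubaraInt M p'.1 + matsubaraInt M ω' = matsubaraInt M p.1 + matsubaraInt M ω ∧ p'.2 = p.2 + k - k'
      · rw [if_pos hc]
      · rw [if_neg hc, hz 0 p' 0 (fun h => hc ⟨h.1, h.2.1⟩), zero_mul, mul_zero]
    · simp only [Fin.sum_univ_two, Fin.mk_one, Fin.isValue]
      rw [hz 1 p' 0 (by simp), zero_mul, mul_zero, zero_add]
      by_cases hc : matsubaraInt M p'.1 + matsubaraInt M ω' = matsubaraInt M p.1 + matsubaraInt M ω ∧ p'.2 = p.2 + k - k'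
      · rw [if_pos hc]
      · rw [if_neg hc, hz 1 p' 1 (fun h => hc ⟨h.1, h.2.1⟩), zero_mul, mul_zero]
  have hmerge : ∀ (p : FreqMomentum L M) (σ : Fin 2),
      -(∑ p' : FreqMomentum L M, ∑ σ' : Fin 2, ℓ₂ p * (ℓ₁ p' *
          (kernel ℂ W 4 ![((p, σ), 1), ((p', σ'), 0), Z₀, Z₃] * kernel ℂ W 4 ![((p, σ), 0), ((p', σ'), 1), Z₁, Z₂]))) -
        ∑ p' : FreqMomentum L M, ∑ σ' : Fin 2, ℓ₂ p' * (ℓ₁ p *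
          (kernel ℂ W 4 ![((p, σ), 1), ((p', σ'), 0), Z₀, Z₃] * kernel ℂ W 4 ![((p, σ), 0), ((p', σ'), 1), Z₁, Z₂])) =
      -(∑ p' : FreqMomentum L M, if matsubaraInt M p'.1 + matsubaraInt M ω' = matsubaraInt M p.1 + matsubaraInt M ω ∧ p'.2 = p.2 + k - k' then
        (ℓ₂ p * ℓ₁ p' + ℓ₁ p * ℓ₂ p') *
          (kernel ℂ W 4 ![((p, σ), 1), ((p', σ), 0), Z₀, Z₃] * kernel ℂ W 4 ![((p, σ), 0), ((p', σ), 1), Z₁, Z₂]) else 0) := by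
    intro p σ
    rw [← neg_add', ← Finset.sum_add_distrib, ← hcons p σ (fun p p' => ℓ₂ p * ℓ₁ p' + ℓ₁ p * ℓ₂ p')]
    congr 1
    refine Finset.sum_congr rfl fun p' _ => ?_
    rw [← Finset.sum_add_distrib]
    refine Finset.sum_congr rfl fun σ' _ => ?_
    ring
  -- assemble
  have hL : ∑ p : FreqMomentum L M, ∑ σ : Fin 2, ℓ₂ p *
        (-(∑ p' : FreqMomentum L M, ∑ σ' : Fin 2, ℓ₁ p' *
            (kernel ℂ W 4 ![((p, σ), 1), ((p', σ'), 0), Z₀, Z₃] * kernel ℂ W 4 ![((p, σ), 0), ((p', σ'), 1), Z₁, Z₂])) -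
          ∑ p' : FreqMomentum L M, ∑ σ' : Fin 2, ℓ₁ p' *
            (kernel ℂ W 4 ![((p, σ), 0), ((p', σ'), 1), Z₀, Z₃] * kernel ℂ W 4 ![((p, σ), 1), ((p', σ'), 0), Z₁, Z₂])) =
      ∑ p : FreqMomentum L M, ∑ σ : Fin 2,
        (-(∑ p' : FreqMomentum L M, ∑ σ' : Fin 2, ℓ₂ p * (ℓ₁ p' *
            (kernel ℂ W 4 ![((p, σ), 1), ((p', σ'), 0), Z₀, Z₃] * kernel ℂ W 4 ![((p, σ), 0), ((p', σ'), 1), Z₁, Z₂]))) -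
          ∑ p' : FreqMomentum L M, ∑ σ' : Fin 2, ℓ₂ p * (ℓ₁ p' *
            (kernel ℂ W 4 ![((p, σ), 0), ((p', σ'), 1), Z₀, Z₃] * kernel ℂ W 4 ![((p, σ), 1), ((p', σ'), 0), Z₁, Z₂]))) := by
    refine Finset.sum_congr rfl fun p _ => Finset.sum_congr rfl fun σ _ => ?_
    rw [mul_sub, mul_neg, Finset.mul_sum, Finset.mul_sum]
    simp only [Finset.mul_sum]
  have hsplit : ∑ p : FreqMomentum L M, ∑ σ : Fin 2,
        (-(∑ p' : FreqMomentum L M, ∑ σ' : Fin 2, ℓ₂ p * (ℓ₁ p' *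
            (kernel ℂ W 4 ![((p, σ), 1), ((p', σ'), 0), Z₀, Z₃] * kernel ℂ W 4 ![((p, σ), 0), ((p', σ'), 1), Z₁, Z₂]))) -
          ∑ p' : FreqMomentum L M, ∑ σ' : Fin 2, ℓ₂ p * (ℓ₁ p' *
            (kernel ℂ W 4 ![((p, σ), 0), ((p', σ'), 1), Z₀, Z₃] * kernel ℂ W 4 ![((p, σ), 1), ((p', σ'), 0), Z₁, Z₂]))) =
      -(∑ p : FreqMomentum L M, ∑ σ : Fin 2, ∑ p' : FreqMomentum L M, ∑ σ' : Fin 2, ℓ₂ p * (ℓ₁ p' *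
            (kernel ℂ W 4 ![((p, σ), 1), ((p', σ'), 0), Z₀, Z₃] * kernel ℂ W 4 ![((p, σ), 0), ((p', σ'), 1), Z₁, Z₂]))) -
        ∑ p : FreqMomentum L M, ∑ σ : Fin 2, ∑ p' : FreqMomentum L M, ∑ σ' : Fin 2, ℓ₂ p * (ℓ₁ p' *
            (kernel ℂ W 4 ![((p, σ), 0), ((p', σ'), 1), Z₀, Z₃] * kernel ℂ W 4 ![((p, σ), 1), ((p', σ'), 0), Z₁, Z₂])) := by
    rw [← neg_add', ← Finset.sum_add_distrib, ← Finset.sum_neg_distrib]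
    refine Finset.sum_congr rfl fun p _ => ?_
    rw [← Finset.sum_add_distrib, ← Finset.sum_neg_distrib]
    refine Finset.sum_congr rfl fun σ _ => ?_
    rw [neg_add']
  rw [hL, hsplit, hB]
  conv_rhs => rw [← Finset.sum_neg_distrib]
  rw [← Finset.sum_neg_distrib, ← Finset.sum_sub_distrib]
  refine Finset.sum_congr rfl fun p _ => ?_
  conv_rhs => rw [← Finset.sum_neg_distrib]
  rw [← Finset.sum_neg_distrib, ← Finset.sum_sub_distrib]
  refine Finset.sum_congr rfl fun σ _ => ?_
  rw [hmerge p σ, neg_inj]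
  refine Finset.sum_congr rfl fun p' _ => ?_
  split_ifs
  · rw [kernel_four_eq_inv_mul_vertexFn β hβ W, kernel_four_eq_inv_mul_vertexFn β hβ W]
    ring
  · ring

end Model

end Summit.HubbardSuperconductivity.HubbardSuperconductivity.Theorems.KLRegimeWickAbs

end
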